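import Literature.AnabelianGeometry.EtaleTheta.Discharge.Sec3CuspidalPreSteps
import Literature.AnabelianGeometry.EtaleTheta.DivisorMonoidsCuspidal
import Literature.AnabelianGeometry.EtaleTheta.RealificationFunctor
import Literature.AnabelianGeometry.EtaleTheta.Discharge.Sec5ModelCaseSlim
import Literature.AnabelianGeometry.EtaleTheta.Discharge.Sec3Rmk372GenuineBase
import Literature.AlgebraicGeometry.Frobenioids.QuasiTemperoidConnectedPart

/-!
# [EtTh] Def. 3.6 (v) and Thm. 5.7 (model case): the K4 closers RE-STATED WITH THE [FrdI] §0 PREDICATE BINDERS SUPPLIED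
# (`IsSharp`, `IsPrimary`, `IsOfFSMType`, `IsSlim`) — generically over the tree vocabulary and at the genuine base `B^temp(Π)⁰`

S. Mochizuki, *The étale theta function and its Frobenioid-theoretic manifestations*, Publ. RIMS **45** (2009):
Def. 3.6 (v) p. 78 («(a) for every non-cuspidal primary element `x ∈ Φ(A)` … there exists `y ∈ Φ^{bs-fld}(A)` such that
`x ≤ y`; (b) … `Prime(Φ(A)) = Prime(Φ(A))^{ncsp} ∪ Prime(Φ(A))^{csp}`»), Prop. 3.4 (i) p. 74 («`Φ₀(Y)` is perf-factorial»),
Rmk. 3.7.2 p. 80 («`D₀` is slim … and of FSM-type»), Thm. 5.7 pp. 103–104 [cite: MochizukiEtTh2009, Def 3.6 p.78;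
Prop 3.4 p.74; Rmk 3.7.2 p.80; Thm 5.7 p.103]; S. Mochizuki, *The geometry of Frobenioids I*, §0 p. 12 («`Prime(M)` … the set
of primes of `M`»; a member of a prime is primary by definition) and *Frobenioids II*, Ex. 1.3 (iii) pp. 11–12 («`B^temp(Π)⁰` is
… of FSM-type») [cite: MochizukiFrdI2008, §0 p.12] [cite: MochizukiFrdII2008, Ex 1.3 (iii) pp.11-12].

abc-iut cell, block C, K4 / C-R33 re-close lane (abc-iut-c312-2 `CONE-K4-RECLOSE.tsv` v4, class PH-INHABITED; director-abc g4-D14),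
seat abc-iut-w6-d047 (gen 5), row «K4-RECLOSE-L2 PH-INHABITED ×3» (cone nodes `EtTh:Def3.6(v)`, `EtTh:Thm5.7`; the third node
`EtTh:Ex3.9(iv)` is re-closed BY EXISTING files, nothing here).  PROOF-ONLY companion (0 definitions, no instance, no new
`Prop`, nothing landed is edited or restated): every theorem below is one of the K4 binder sites with the flagged [FrdI] §0
predicate binder SUPPLIED by its accepted producer —

* §1 `EtTh:Def3.6(v)`, site `DivisorMonoids.primes_ncsp_or_csp` (binder `hS : IsSharp (Φ₀(Y))`, FACT row F-2362): `hS` is a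
  THEOREM as soon as `Φ₀(Y)` is perf-factorial (Prop. 3.4 (i); [FrdI] Def. 2.4 (i): perf-factorial ⟹ divisorial ⟹ sharp), and for
  EVERY Def. 3.6 (i) datum over the tree vocabulary `Φ₀(Y)` IS perf-factorial (`RealifiedDivisorMonoids.isPerfFactorial_Φ₀`):
  `DivisorMonoids.primes_ncsp_or_csp_of_isPerfFactorial`, `RealifiedDivisorMonoids.primes_ncsp_or_csp_treeVocab` (NO binder);
* §2 `EtTh:Def3.6(v)`, sites `TemperedFrobenioid.isNonCuspidal_iff_exists_bsFld_dvd` / `isCuspidal_iff_not_isNonCuspidal` /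
  `isNonCuspidal_div_iff_exists_factor` (binder `hx : IsPrimary x`, FACT row F-1126 — a premise on the ELEMENT `x ∈ Φ(A)`): the
  same three statements in print's own PRIME-INDEXED quantifier form («`Prime(Φ(A)) = …`»: for every prime `𝔭` of `Φ(A)` and
  every member `x ∈ 𝔭`), the membership supplying `IsPrimary x` by [FrdI] §0's definition of `Prime(M)`; with the NON-VACUITY
  lemma `TemperedFrobenioid.exists_mem_primes_precsim_of_ne_one`: over the tree vocabulary (`Φ(A)` perf-factorial, Def. 3.6 (ii))
  every `x ≠ 0` of `Φ(A)` lies above a member of some prime — so the prime-indexed statements are inhabited at every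
  tempered Frobenioid of the tree vocabulary with a non-zero divisor;
* §3 `EtTh:Thm5.7`, sites `ThetaFrobenioid.rootTransport_of_model` / `rootTransport_of_model_slim` (binder `hD : IsOfFSMType D`,
  FACT row F-2311; `_slim` also `hslim : IsSlim D`): the model-case closers AT THE GENUINE BASE CLASS `D := B^temp(Π)⁰ =
  ConnectedPart (BTemp Π)` — for EVERY topological group `Π` (`hD :=` abc-iut-L1-t4's
  `QuasiTemperoid.BTempConnected.connectedPart_isOfFSMType`, [FrdII] Ex. 1.3 (iii)) and, for the slim form, at `Π := Π^tp_X` of a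
  [SemiAnbd] Ex. 3.10 datum `X : TemperedArithmeticGroup K` (`hD, hslim :=` `TemperedArithmeticGroup.remark372_holds`, Rmk. 3.7.2)
  — every other hypothesis being the model-case closer's printed input VERBATIM.

HONEST FRAMING: kernel re-keying of landed theorems (no new mathematics); «re-closed at OUR carrier / generically over OUR
vocabulary» reads exactly that — nothing about print beyond it; refereed pre-IUT material ([EtTh], [FrdI], [FrdII]); nothing
here bears on [IUTchIII] Cor. 3.12; no side taken; typed ≠ proved; nothing here asserts abc proved or refuted.
-/

namespace Literature.AnabelianGeometry.EtaleTheta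

open CategoryTheory Opposite Literature.AlgebraicGeometry.Frobenioids Literature.AnabelianGeometry.SemiGraphs

/-! ### §1 Definition 3.6 (v)(b) at the level of `Φ₀(Y)` — the `IsSharp` binder supplied by perf-factoriality (Prop. 3.4 (i)) -/

namespace DivisorMonoids

universe u v w

variable {D₀ : Type u} [Category.{v} D₀] (T : DivisorMonoids.{u, v, w} D₀) (Y : D₀ᵒᵖ)

/-- **Def. 3.6 (v)(b) at the level of `Φ₀(Y)`, for `Φ₀(Y)` perf-factorial (Prop. 3.4 (i)) — NO `IsSharp` binder**: every prime
of `Φ₀(Y)` is non-cuspidal (all its members are) or cuspidal (all its members are); abc-iut-L2-d2's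
`DivisorMonoids.primes_ncsp_or_csp` with `hS := hpf.isDivisorial.isSharp` ([FrdI] Def. 2.4 (i): perf-factorial ⟹ divisorial ⟹
sharp). [cite: MochizukiEtTh2009, Def 3.6 p.78; Prop 3.4 p.74] -/
theorem primes_ncsp_or_csp_of_isPerfFactorial (hpf : IsPerfFactorial (T.Φ₀.obj Y)) (𝔭 : Primes (T.Φ₀.obj Y)) :
    (∀ e ∈ 𝔭.carrier, e ∈ T.ncsp₀ Y) ∨ (∀ e ∈ 𝔭.carrier, e ∈ T.csp₀ Y) :=
  T.primes_ncsp_or_csp Y hpf.isDivisorial.isSharp 𝔭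

/-- … and not both (bookkeeping twin, binder-free already: abc-iut-L2-d2's `primes_not_ncsp_and_csp`), packaged with the
dichotomy as an exclusive or. [cite: MochizukiEtTh2009, Def 3.6 p.78] -/
theorem primes_ncsp_xor_csp_of_isPerfFactorial (hpf : IsPerfFactorial (T.Φ₀.obj Y)) (𝔭 : Primes (T.Φ₀.obj Y)) :
    Xor (∀ e ∈ 𝔭.carrier, e ∈ T.ncsp₀ Y) (∀ e ∈ 𝔭.carrier, e ∈ T.csp₀ Y) := by
  rcases T.primes_ncsp_or_csp_of_isPerfFactorial Y hpf 𝔭 with h | h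
  · exact Or.inl ⟨h, fun h' => T.primes_not_ncsp_and_csp Y 𝔭 ⟨h, h'⟩⟩
  · exact Or.inr ⟨h, fun h' => T.primes_not_ncsp_and_csp Y 𝔭 ⟨h', h⟩⟩

end DivisorMonoids

namespace RealifiedDivisorMonoids

universe u v w

variable {D₀ : Type u} [Category.{v} D₀] (T : RealifiedDivisorMonoids (D₀ := D₀) treeMonoidVocab.{w}) (Y : D₀ᵒᵖ)

/-- **Def. 3.6 (v)(b) at the level of `Φ₀(Y)` for EVERY Def. 3.6 (i) datum over the tree vocabulary — NO binder at all**: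
`Φ₀(Y)` is perf-factorial by `RealifiedDivisorMonoids.isPerfFactorial_Φ₀` (the realification field), hence sharp.
[cite: MochizukiEtTh2009, Def 3.6 p.78; Prop 3.4 p.74] -/
theorem primes_ncsp_or_csp_treeVocab (𝔭 : Primes (T.Φ₀.obj Y)) :
    (∀ e ∈ 𝔭.carrier, e ∈ T.ncsp₀ Y) ∨ (∀ e ∈ 𝔭.carrier, e ∈ T.csp₀ Y) :=
  T.toDivisorMonoids.primes_ncsp_or_csp_of_isPerfFactorial Y (T.isPerfFactorial_Φ₀ Y) 𝔭

/-- `Φ₀(Y)` is sharp for every Def. 3.6 (i) datum over the tree vocabulary (the F-2362 binder of abc-iut-L2-d2's `Φ₀`-level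
support calculus, as a theorem). [cite: MochizukiEtTh2009, Prop 3.4 p.74] -/
theorem isSharp_Φ₀_treeVocab : IsSharp (T.Φ₀.obj Y) :=
  (T.isPerfFactorial_Φ₀ Y).isDivisorial.isSharp

end RealifiedDivisorMonoids

/-! ### §2 Definition 3.6 (v) for members of primes of `Φ(A)` — the `IsPrimary` binder supplied by membership in a prime -/

namespace TemperedFrobenioid

universe u₀ v₀ u v w

variable {D₀ : Type u₀} [Category.{v₀} D₀] {T : RealifiedDivisorMonoids (D₀ := D₀) treeMonoidVocab.{w}}
  {D : Type u} [Category.{v} D] {VD : FrdICatStub.{u, v, w} D} (C : TemperedFrobenioid T D VD)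

/-- A member of a prime of `Φ(A)` is primary ([FrdI] §0 p. 12: `𝔭 ⊆ M` is a `≼`-class of primary elements).
[cite: MochizukiFrdI2008, §0 p.12] -/
theorem isPrimary_of_mem_primes {A : Dᵒᵖ} (𝔭 : Primes (C.Φ.carrier A)) {x : C.Φ.carrier A} (hx : x ∈ 𝔭.carrier) :
    IsPrimary x := by
  obtain ⟨h, -⟩ := hx
  exact h

/-- **NON-VACUITY over the tree vocabulary**: `Φ(A)` is perf-factorial (Def. 3.6 (ii)), so every `x ≠ 0` of `Φ(A)` lies `≽` some
member `m` of some prime `𝔭 ∈ Prime(Φ(A))` ([FrdI] Def. 2.4 (i)(c)) — the prime-indexed statements below are inhabited at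
every tempered Frobenioid of the tree vocabulary with a non-zero divisor. [cite: MochizukiEtTh2009, Def 3.6 p.77] -/
theorem exists_mem_primes_precsim_of_ne_one {A : Dᵒᵖ} {x : C.Φ.carrier A} (hx : x ≠ 1) :
    ∃ (𝔭 : Primes (C.Φ.carrier A)) (m : C.Φ.carrier A), m ∈ 𝔭.carrier ∧ Precsim m x := by
  obtain ⟨m, hm, hmx⟩ := (C.isPerfFactorial A).exists_isPrimary_precsim hx
  exact ⟨Quotient.mk (primarySetoid _) ⟨m, hm⟩, m, ⟨hm, rfl⟩, hmx⟩

/-- In particular `Prime(Φ(A))` is non-empty as soon as `Φ(A) ≠ 0`. [cite: MochizukiEtTh2009, Def 3.6 p.77] -/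
theorem nonempty_primes_of_ne_one {A : Dᵒᵖ} {x : C.Φ.carrier A} (hx : x ≠ 1) : Nonempty (Primes (C.Φ.carrier A)) := by
  obtain ⟨𝔭, -⟩ := C.exists_mem_primes_precsim_of_ne_one hx
  exact ⟨𝔭⟩

/-- **Def. 3.6 (v)(a) for members of primes** — abc-iut-L2-d2's `isNonCuspidal_iff_exists_bsFld_dvd` with its `IsPrimary` binder
supplied by membership in a prime: for `𝔭 ∈ Prime(Φ(A))` and `x ∈ 𝔭`, `x` is non-cuspidal iff `x ≤ y` for some
base-field-theoretic `y`. [cite: MochizukiEtTh2009, Def 3.6 p.78] -/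
theorem isNonCuspidal_iff_exists_bsFld_dvd_of_mem_primes (hp : C.IsCuspidallyPure)
    (hD1 : ∀ (A : Dᵒᵖ) (y : C.Φ.carrier A), C.IsBaseFieldTheoreticDiv y → C.IsNonCuspidal y)
    (hDn : ∀ (A : Dᵒᵖ) (x : C.Φ.carrier A),
      C.IsNonCuspidal x ↔ ∀ y : C.Φ.carrier A, IsPrimary y → Precsim y x → C.IsNonCuspidal y)
    {A : Dᵒᵖ} (𝔭 : Primes (C.Φ.carrier A)) {x : C.Φ.carrier A} (hx : x ∈ 𝔭.carrier) :
    C.IsNonCuspidal x ↔ ∃ y : C.Φ.carrier A, C.IsBaseFieldTheoreticDiv y ∧ x ∣ y :=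
  C.isNonCuspidal_iff_exists_bsFld_dvd hp hD1 hDn (C.isPrimary_of_mem_primes 𝔭 hx)

/-- **Def. 3.6 (v)(b) for members of primes** («`Prime(Φ(A)) = Prime(Φ(A))^{ncsp} ∪ Prime(Φ(A))^{csp}`», disjointly) —
abc-iut-L2-d2's `isCuspidal_iff_not_isNonCuspidal` with its `IsPrimary` binder supplied by membership in a prime.
[cite: MochizukiEtTh2009, Def 3.6 p.78] -/
theorem isCuspidal_iff_not_isNonCuspidal_of_mem_primes (hp : C.IsCuspidallyPure)
    (hDa : ∀ (A : Dᵒᵖ) (x : C.Φ.carrier A), C.IsNonCuspidal x → C.IsCuspidal x → x = 1)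
    {A : Dᵒᵖ} (𝔭 : Primes (C.Φ.carrier A)) {x : C.Φ.carrier A} (hx : x ∈ 𝔭.carrier) :
    C.IsCuspidal x ↔ ¬ C.IsNonCuspidal x :=
  C.isCuspidal_iff_not_isNonCuspidal hp hDa (C.isPrimary_of_mem_primes 𝔭 hx)

/-- **Def. 3.6 (v)(b), prime by prime**: for each prime `𝔭` of `Φ(A)`, either every member of `𝔭` is non-cuspidal or every member
of `𝔭` is cuspidal (non-cuspidality is `≼`-invariant among primary elements by `hDn`; the rest is (b) for members).
[cite: MochizukiEtTh2009, Def 3.6 p.78] -/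
theorem primes_ncsp_or_csp (hp : C.IsCuspidallyPure)
    (hDa : ∀ (A : Dᵒᵖ) (x : C.Φ.carrier A), C.IsNonCuspidal x → C.IsCuspidal x → x = 1)
    (hDn : ∀ (A : Dᵒᵖ) (x : C.Φ.carrier A),
      C.IsNonCuspidal x ↔ ∀ y : C.Φ.carrier A, IsPrimary y → Precsim y x → C.IsNonCuspidal y)
    {A : Dᵒᵖ} (𝔭 : Primes (C.Φ.carrier A)) :
    (∀ x ∈ 𝔭.carrier, C.IsNonCuspidal x) ∨ (∀ x ∈ 𝔭.carrier, C.IsCuspidal x) := by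
  classical
  by_cases h : ∃ x ∈ 𝔭.carrier, C.IsNonCuspidal x
  · obtain ⟨x, hx, hn⟩ := h
    refine Or.inl fun y hy => ?_
    exact (hDn A x).1 hn y (C.isPrimary_of_mem_primes 𝔭 hy) (𝔭.precsim_of_mem_carrier hy hx)
  · push Not at h
    exact Or.inr fun y hy => (C.isCuspidal_iff_not_isNonCuspidal_of_mem_primes hp hDa 𝔭 hy).2 (h y hy)

variable {C}

/-- **Def. 3.6 (v)(a) for PRE-STEPS whose zero divisor is a member of a prime** — abc-iut-L2-d2's
`isNonCuspidal_div_iff_exists_factor` ([FrdI] Def. 1.3 (iii)(d) form used in the proof of Cor. 3.8 (iii), p. 82) with its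
`IsPrimary` binder supplied by membership in a prime. [cite: MochizukiEtTh2009, Cor 3.8 p.82] -/
theorem isNonCuspidal_div_iff_exists_factor_of_mem_primes (hp : C.IsCuspidallyPure)
    (hD1 : ∀ (A : Dᵒᵖ) (y : C.Φ.carrier A), C.IsBaseFieldTheoreticDiv y → C.IsNonCuspidal y)
    (hDn : ∀ (A : Dᵒᵖ) (x : C.Φ.carrier A),
      C.IsNonCuspidal x ↔ ∀ y : C.Φ.carrier A, IsPrimary y → Precsim y x → C.IsNonCuspidal y)
    {A B : C.category} {φ : A ⟶ B} (hφ : PreFrobenioid.IsPreStep C.toElem φ)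
    (𝔭 : Primes (C.Φ.carrier (op A.base))) (hx : ModelFrobenioid.div φ ∈ 𝔭.carrier) :
    C.IsNonCuspidal (ModelFrobenioid.div φ) ↔
      ∃ (B' : C.category) (ψ : A ⟶ B') (χ : B ⟶ B'),
        PreFrobenioid.IsPreStep C.toElem ψ ∧ C.IsBaseFieldTheoretic ψ ∧ φ ≫ χ = ψ :=
  isNonCuspidal_div_iff_exists_factor hp hD1 hDn hφ (C.isPrimary_of_mem_primes 𝔭 hx)

end TemperedFrobenioid

/-! ### §3 Theorem 5.7 (model case) at the genuine base class `B^temp(Π)⁰` — the `IsOfFSMType` / `IsSlim` binders supplied -/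

namespace ThetaFrobenioid

universe w u₀

section BTemp

variable {G : Type u₀} [Group G] [TopologicalSpace G]
  {Φ B : (ConnectedPart (BTemp G))ᵒᵖ ⥤ CommMonCat.{w}} {DivB : B ⟶ monoidGp Φ}
  {𝔉 : ThetaFrobenioid.{w} (ModelFrobenioid Φ B DivB) (ConnectedPart (BTemp G))}
  (Ψ : ModelFrobenioid Φ B DivB ≌ ModelFrobenioid Φ B DivB)
  (α : Ψ.functor.obj 𝔉.AN ≅ 𝔉.AN) (β : Ψ.functor.obj 𝔉.BN ≅ 𝔉.BN)

/-- **[EtTh] Theorem 5.7 at the `N`-th root, model case, AT THE GENUINE BASE `B^temp(Π)⁰` — NO `IsOfFSMType` binder**: for §5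
data over a model tempered Frobenioid over `D := ConnectedPart (BTemp Π)` (ANY topological group `Π`), abc-iut-L2's
`rootTransport_of_model` with `hD :=` [FrdII] Ex. 1.3 (iii) «`B^temp(Π)⁰` is of FSM-type»
(`QuasiTemperoid.BTempConnected.connectedPart_isOfFSMType`); MODULO exactly the printed inputs of the model-case closer:
"`Ψ` preserves base-equivalent pairs" (`hbe`), Prop. 5.3 (vi) read at `A_N` (`hdiv`), and Thm. 5.7's rigidity clause at level `N`
(`hrig`). [cite: MochizukiEtTh2009, Thm 5.7 p.103] -/
theorem rootTransport_of_model_bTemp (h𝔉 : 𝔉.pre = PreFrobenioidData.ofModel Φ B DivB)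
    (h : ModelFrobenioid.Hypotheses Φ B)
    (hbe : ∀ ⦃A X : ModelFrobenioid Φ B DivB⦄ (φ ψ : A ⟶ X), 𝔉.pre.BaseEquivalent φ ψ →
      𝔉.pre.BaseEquivalent (Ψ.functor.map φ) (Ψ.functor.map ψ))
    (hdiv : ∃ e : 𝔉.AN ≅ 𝔉.AN,
      𝔉.pre.div (α.inv ≫ Ψ.functor.map 𝔉.sCap ≫ β.hom) = 𝔉.pre.div (e.hom ≫ 𝔉.sCap) ∧
      𝔉.pre.div (α.inv ≫ Ψ.functor.map 𝔉.sCup ≫ β.hom) = 𝔉.pre.div (e.hom ≫ 𝔉.sCup))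
    (hrig : ∀ (e : 𝔉.AN ≅ 𝔉.AN) (Dc Dp : Aut 𝔉.BN),
      α.inv ≫ Ψ.functor.map 𝔉.sCap ≫ β.hom = e.hom ≫ 𝔉.sCap ≫ Dc.hom →
      α.inv ≫ Ψ.functor.map 𝔉.sCup ≫ β.hom = e.hom ≫ 𝔉.sCup ≫ Dp.hom →
      Dc⁻¹ * Dp ∈ 𝔉.units 𝔉.BN → Dc⁻¹ * Dp ∈ 𝔉.muTorsion 𝔉.BN (2 * 𝔉.l * 𝔉.N) ⊓ 𝔉.OKxRootN) :
    𝔉.RootTransport Ψ α β :=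
  rootTransport_of_model Ψ α β h𝔉 h QuasiTemperoid.BTempConnected.connectedPart_isOfFSMType hbe hdiv hrig

/-- **Transport up to a unit, model case, at the genuine base `B^temp(Π)⁰`** (proof of Thm. 5.6 / Rmk. 5.7.1) — abc-iut-L2's
`exists_codTransport_of_div_eq_model` with `hD := connectedPart_isOfFSMType`. [cite: MochizukiEtTh2009, Thm 5.6 p.103] -/
theorem exists_codTransport_of_div_eq_model_bTemp (h𝔉 : 𝔉.pre = PreFrobenioidData.ofModel Φ B DivB)
    (h : ModelFrobenioid.Hypotheses Φ B)
    (hbe : ∀ ⦃A X : ModelFrobenioid Φ B DivB⦄ (φ ψ : A ⟶ X), 𝔉.pre.BaseEquivalent φ ψ →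
      𝔉.pre.BaseEquivalent (Ψ.functor.map φ) (Ψ.functor.map ψ))
    (e : 𝔉.AN ≅ 𝔉.AN)
    (hcap : 𝔉.pre.div (α.inv ≫ Ψ.functor.map 𝔉.sCap ≫ β.hom) = 𝔉.pre.div (e.hom ≫ 𝔉.sCap))
    (hcup : 𝔉.pre.div (α.inv ≫ Ψ.functor.map 𝔉.sCup ≫ β.hom) = 𝔉.pre.div (e.hom ≫ 𝔉.sCup)) :
    ∃ Dc Dp : Aut 𝔉.BN,
      α.inv ≫ Ψ.functor.map 𝔉.sCap ≫ β.hom = e.hom ≫ 𝔉.sCap ≫ Dc.hom ∧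
      α.inv ≫ Ψ.functor.map 𝔉.sCup ≫ β.hom = e.hom ≫ 𝔉.sCup ≫ Dp.hom ∧
      Dc⁻¹ * Dp ∈ 𝔉.units 𝔉.BN :=
  exists_codTransport_of_div_eq_model Ψ α β h𝔉 h QuasiTemperoid.BTempConnected.connectedPart_isOfFSMType hbe e hcap hcup

end BTemp

section TemperedArithmeticGroup

variable {K : Type u₀} [Field K] (X : TemperedArithmeticGroup.{u₀} K)
  {Φ B : (ConnectedPart (BTemp X.Pi))ᵒᵖ ⥤ CommMonCat.{w}} {DivB : B ⟶ monoidGp Φ}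
  {𝔉 : ThetaFrobenioid.{w} (ModelFrobenioid Φ B DivB) (ConnectedPart (BTemp X.Pi))}
  (Ψ : ModelFrobenioid Φ B DivB ≌ ModelFrobenioid Φ B DivB)
  (α : Ψ.functor.obj 𝔉.AN ≅ 𝔉.AN) (β : Ψ.functor.obj 𝔉.BN ≅ 𝔉.BN)

/-- **[EtTh] Theorem 5.7 at the `N`-th root, model case, no [FrdI] binder, AT THE GENUINE BASE `B^temp(X^log)⁰` of a [SemiAnbd]
Ex. 3.10 datum `X` (`Π^tp_X` tempered and temp-slim) — NO `IsOfFSMType` / `IsSlim` binder**: abc-iut-L2's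
`rootTransport_of_model_slim` with `hD, hslim :=` Rmk. 3.7.2 at the genuine connected temperoid
(`TemperedArithmeticGroup.remark372_holds X`); MODULO exactly its remaining printed inputs (`Φ` non-dilating `hnd`, `C` not of
group-like type `hN`, Prop. 5.3 (vi) at `A_N` `hdiv`, the rigidity clause `hrig`). [cite: MochizukiEtTh2009, Thm 5.7 p.103; Rmk 3.7.2 p.80] -/
theorem rootTransport_of_model_slim_bTemp (h𝔉 : 𝔉.pre = PreFrobenioidData.ofModel Φ B DivB)
    (h : ModelFrobenioid.Hypotheses Φ B) (hnd : IsNonDilatingOn Φ)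
    (hN : ∃ A : ModelFrobenioid Φ B DivB, ¬ (PreFrobenioidData.ofModel Φ B DivB).IsGroupLikeObj A)
    (hdiv : ∃ e : 𝔉.AN ≅ 𝔉.AN,
      𝔉.pre.div (α.inv ≫ Ψ.functor.map 𝔉.sCap ≫ β.hom) = 𝔉.pre.div (e.hom ≫ 𝔉.sCap) ∧
      𝔉.pre.div (α.inv ≫ Ψ.functor.map 𝔉.sCup ≫ β.hom) = 𝔉.pre.div (e.hom ≫ 𝔉.sCup))
    (hrig : ∀ (e : 𝔉.AN ≅ 𝔉.AN) (Dc Dp : Aut 𝔉.BN),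
      α.inv ≫ Ψ.functor.map 𝔉.sCap ≫ β.hom = e.hom ≫ 𝔉.sCap ≫ Dc.hom →
      α.inv ≫ Ψ.functor.map 𝔉.sCup ≫ β.hom = e.hom ≫ 𝔉.sCup ≫ Dp.hom →
      Dc⁻¹ * Dp ∈ 𝔉.units 𝔉.BN → Dc⁻¹ * Dp ∈ 𝔉.muTorsion 𝔉.BN (2 * 𝔉.l * 𝔉.N) ⊓ 𝔉.OKxRootN) :
    𝔉.RootTransport Ψ α β :=
  rootTransport_of_model_slim Ψ α β h𝔉 h (TemperedArithmeticGroup.remark372_holds X).2.1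
    (TemperedArithmeticGroup.remark372_holds X).1 hnd hN hdiv hrig

/-- **[EtTh] Thm. 4.4 (i) for the model at the genuine base `B^temp(X^log)⁰`, no [FrdI] binder and NO `IsOfFSMType` / `IsSlim`
binder**: a faithful `Ψ^bs` with `Ψ ⋙ Base ≅ Base ⋙ Ψ^bs` — abc-iut-L2's `exists_compatBase_of_model_slim` with Rmk. 3.7.2
supplied. [cite: MochizukiEtTh2009, Thm 4.4 (i) p.94; Rmk 3.7.2 p.80] -/
theorem exists_compatBase_of_model_slim_bTemp (h𝔉 : 𝔉.pre = PreFrobenioidData.ofModel Φ B DivB)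
    (h : ModelFrobenioid.Hypotheses Φ B) (hnd : IsNonDilatingOn Φ)
    (hN : ∃ A : ModelFrobenioid Φ B DivB, ¬ (PreFrobenioidData.ofModel Φ B DivB).IsGroupLikeObj A) :
    ∃ (Ψbs : ConnectedPart (BTemp X.Pi) ⥤ ConnectedPart (BTemp X.Pi)) (_ : Ψbs.Faithful),
      Nonempty (Ψ.functor ⋙ 𝔉.base ≅ 𝔉.base ⋙ Ψbs) :=
  exists_compatBase_of_model_slim Ψ h𝔉 h (TemperedArithmeticGroup.remark372_holds X).2.1
    (TemperedArithmeticGroup.remark372_holds X).1 hnd hN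

end TemperedArithmeticGroup

end ThetaFrobenioid

end Literature.AnabelianGeometry.EtaleTheta
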